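import Summits.Langlands.Langlands.Theorems.SqrtFiveQuarticCoversE7DescentW
import Summits.Langlands.Langlands.Theorems.SqrtFiveQuarticCoversW5DescentRatPoints
import Summits.Langlands.Langlands.Theorems.SqrtFiveQuarticCoversCertB3E7MordellWeilQ

/-!
# Route `Langlands/SqrtFiveQuarticCovers`, sheet 4.5 (`CertB3E7`, stmt-Langlands-23416): the registered stub
# `MordellWeilE7` CLOSED BY NAME from the two kernel theorems hQ (`W_ratPoints`, eng-8 g3, p679899) and
# hQ5 (`W5Descent.ratPoints`, eng-7 g5, p680761) via `mordellWeilE7_of_ratPoints` (p677449)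

Cell lg-quartmod (F-L1); the by-name step (δ) of row 8 of the NAMED-INPUT TABLE (lead g2 rulings 23:58:49Z,
00:08:19Z, 00:24:40Z «(δ) ownership, timed»: eng-7 g5 fallback-live, submit at 00:36Z unless eng-8 g3 has).  The
statement is the registered stub text of `MordellWeilE7` pulled from `ledger workitem get stmt-Langlands-23416 --json`
at 00:22Z, character for character; the proof term is the composition ref-1 g2 elaborated from the tree (00:10:36Z).
HONEST STATUS: the named Mordell–Weil input of sheet 4.5 («X(e7)(ℚ(√5)) = {(−1/3, ±14/9)} with the group law read on
x») is now a THEOREM: both ℚ-point lists (49a4 and its 5-twist of conductor 1225) are proved in the kernel by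
elementary 2-isogeny descents; it is not a modularity or BSD statement; `CertB3E7` still rests on the model
identification `ModelIdentificationB3E7(Inf)`; nothing here proves modularity of a new class of elliptic curves.
-/

set_option linter.dupNamespace false -- project-wide option; `Summit.Langlands.Langlands` is the mandated namespace

namespace Summit.Langlands.Langlands.Theorems.SqrtFiveQuarticCovers

/-- **Stub `MordellWeilE7` of stmt-Langlands-23416, BY NAME and unconditionally**: for a quartic number field
`K ∋ r`, `r² = 5`, a ring endomorphism `σ ≠ id` fixing `r`, and a `K`-point `(x, y)` of FLS's model
`y² = 7(16x⁴ + 68x³ + 111x² + 62x + 11)` of `X(e7)`: `σx = x` or `(12x + 5)·σx = −(5x + 2)`.  Proof: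
`mordellWeilE7_of_ratPoints` (p677449: hMW ⟸ hQ ∧ hQ5, then typ-1's group-law module p674866) applied to the
kernel theorems `W_ratPoints` (49a4(ℚ) = {O, T}) and `W5Descent.ratPoints` (its 5-twist, conductor 1225).
[cite: FreitasLeHungSiksek2015, Lemma 4.2 (arXiv:1310.7088 p. 28)] -/
theorem MordellWeilE7 : ∀ (K : Type) [Field K] [NumberField K], Module.finrank ℚ K = 4 → ∀ r : K, r ^ 2 = 5 → ∀ σ : K →+* K, σ r = r → σ ≠ RingHom.id K → ∀ x y : K, y ^ 2 = 7 * (16 * x ^ 4 + 68 * x ^ 3 + 111 * x ^ 2 + 62 * x + 11) → (σ x = x ∨ (12 * x + 5) * σ x = -(5 * x + 2)) :=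
  mordellWeilE7_of_ratPoints W_ratPoints W5Descent.ratPoints

end Summit.Langlands.Langlands.Theorems.SqrtFiveQuarticCovers
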